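import Literature.NumberTheory.Automorphic.AutomorphicRepsGLCuspidalL2Step1Bump
import Literature.NumberTheory.Automorphic.GLnCuspidalSpectrumProofs
import Literature.NumberTheory.Automorphic.LocalTestFunctionTestClass
import HarnessLib

/-!
# A test vector of a cuspidal `Π` which is locally admissible at every finite place

Topic `NumberTheory/Automorphic`; namespace `Literature.NumberTheory.Automorphic`. Theorems only (no
definition, no named fact, no instance visible to importers). A brick of the local half of the
printed proof of Arthur–Clozel (2.3) in rank `2` (named fact
`JacquetShalika1981_partialPairL_pole_of_eq_conj`; reduced by `PairLFunctionPolesEqConjFirstMoment` to the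
absolute convergence AT `s = 1` of the bad-place part of the unfolded Rankin–Selberg integral of ONE
smoothed datum `S_η f` per cuspidal `Π`): the Kirillov asymptotics of the Whittaker coefficient of
`S_η f` at a finite place `v` are read off the Jacquet module of the `GL_n(K_v)`-module generated by
`S_η f`, which must therefore be **admissible** (finite-dimensional spaces of `ι_v(U)`-fixed vectors).
The printed proofs take this from the admissibility of `Π` (Harish-Chandra's finiteness theorem and
quasi-simplicity, Borel–Jacquet (1979), 4.6; in the tree the named facts
`harishChandra_finiteness_gl`, `formsOfL2_hasZCharacter`). This file provides such a datum
UNCONDITIONALLY, by the compact-operator argument of Gelfand–Graev–Piatetski-Shapiro (Bump (1997),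
proofs of Thm. 3.2.2–3.2.3 and 3.3.3) already used in the tree's construction of local components
(`GLnCuspidalSpectrumProofs`, `localEigenspace`): choose the test vector to be an EIGENVECTOR of one
compact self-adjoint smoothing operator `R(η)|_Π` whose weight is a PRODUCT
`η = η_∞ ⊗ 𝟙_{K_f(𝔫)}` — then for every finite `v` the weight is `ξ_{U_v} = η(s_v ·) 𝟙_{U_v}((·)_v)`
for the local level `U_v = K(𝔫)_v`, so the eigenvector lies in the `GL_n(K_v)`-stable, locally
finite-dimensional space `E_c` of joint eigenvectors of the local smoothings at `v`, simultaneously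
for all `v`.

* `exists_symmetric_productTestWeight` — for `V ∈ 𝓝 1` in `GL_n(𝔸_K)`: a test function
  `η ≥ 0` (`IsTestFunctionGL`), `η(1) = 1`, `η(g⁻¹) = η(g)`, supported in `V`, and an ideal `𝔫 ≠ 0`
  with `η` left and right `K(𝔫)`-invariant and **supported in `{g | g_f ∈ K_f(𝔫)}`** (the
  construction `η(g) = φ(Q(g_∞ - 1)) φ(Q(g_∞⁻¹ - 1)) · 𝟙_{K_f(𝔫)}(g_f)` of
  `AutomorphicRepsGL.exists_adInvariant_symmetric_testWeight_holds`, with the level and the support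
  clause exported);
* `isCompact_isOpen_levelAt`, `toAdelic_mem_principalCongruenceLevel_of_mem_levelAt`,
  `toLocalAt_mem_levelAt_of_apply_ne_zero`, `localTestWeight_levelAt_eq_self` — the local level
  `U_v = {x ∈ GL_n(K_v) | |x - 1|_v ≤ |𝔫|_v, x, x⁻¹ integral}` (`valuedCongruenceSubgroup` of radius
  `idealRadius K v 𝔫`) is compact open, `ι_v(U_v) ⊆ K(𝔫)`, and **`ξ_{U_v} = η`**: such an `η` is its
  own local test weight at every finite place;
* `CuspidalAutomorphicRepGL.exists_eigen_productTestVector` (**main**) — in every cuspidal `Π` of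
  `GL_n(𝔸_K)` there are `f ≠ 0`, such a pair `(η, 𝔫)` and a real `c ≠ 0` with `R(η) f = c f`
  (`smoothedVector`; a non-zero real eigenvalue of the compact self-adjoint `R(η)|_Π`, which is
  non-zero on a suitable `f₀`, `smoothedVector_ne_zero_of_support_subset`);
* `CuspidalAutomorphicRepGL.mem_localEigenspace_of_eigen_productTestVector`,
  `CuspidalAutomorphicRepGL.exists_eigen_productTestVector_locallyAdmissible` — consequently, for
  every finite `v`, `f` is `ι_v(U_v)`-fixed, `R_{U_v} f = c f`, and `f` lies in the `GL_n(K_v)`-stable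
  subspace `E_{c / mass U_v}` of `Π`, all of whose `ι_v(U)`-fixed parts (`U` compact open) are
  finite-dimensional (`finiteDimensional_localEigenspace_inf_fixedVectors`): **the `GL_n(K_v)`-module
  generated by `f` is admissible, at every finite place, with no admissibility of `Π` assumed.**

Since `S_η f` represents `R(η) f = c f ≠ 0`, the datum `(f, η)` is admissible for
`JacquetShalika1981_partialPairL_pole_of_eq_conj_of_firstMoment`.

## References

* D. Bump, *Automorphic forms and representations* (1997), proofs of Thm. 3.2.2–3.2.3 (PDF p. 281),
  Thm. 3.3.3 and its proof (PDF p. 296), proof of Lemma 2.3.2 (PDF p. 163) [Bump1997].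
* I. M. Gelfand, M. I. Graev, I. I. Piatetski-Shapiro, *Representation theory and automorphic
  functions* (1969), Ch. 3 [GelfandGraevPiatetskiShapiro1969].
* A. Borel, H. Jacquet, *Automorphic forms and automorphic representations* (1979), §4.6
  [BorelJacquet1979].
-/

-- Mathlib idiom (Mathlib/Algebra/Lie/OfAssociative.lean); needed to mention Lie subalgebras of matrix algebras
attribute [local instance 100] LieRing.ofAssociativeRing

open scoped MatrixGroups Matrix ContDiff Classical Topology Pointwise
open NumberField NumberField.mixedEmbedding IsDedekindDomain Filter
open _root_.MeasureTheory

noncomputable section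

namespace Literature.NumberTheory.Automorphic

attribute [local instance] adelicBorel borelSpace_adelic locallyCompactSpace_adelic
  secondCountableTopology_gl_adelic

-- `M_n(K ⊗ ℝ)` is finite-dimensional over `ℝ` (the tree's instance, as in `AutomorphicRepsGLCuspidalL2Step1Bump`)
attribute [local instance] finiteDimensional_matrix_mixedSpace

/-! ### 1. Symmetric product test functions `η_∞ ⊗ 𝟙_{K_f(𝔫)}` -/

section Product

variable {n : ℕ} {K : Type} [Field K] [NumberField K]

open scoped Matrix.Norms.Operator in
set_option backward.isDefEq.respectTransparency false in
/-- **Symmetric product test functions with small support.** For every neighbourhood `V` of `1` in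
`GL_n(𝔸_K)` there are a test function `η ≥ 0` (`IsTestFunctionGL`) with `η(1) = 1`, `η(g⁻¹) = η(g)`,
`support η ⊆ V`, and an ideal `𝔫 ≠ 0` such that `η` is left and right invariant under the principal
congruence subgroup `K(𝔫)` and is supported in `{g | g_f ∈ K_f(𝔫)}`. Construction of
`AutomorphicRepsGL.exists_adInvariant_symmetric_testWeight_holds` (Bump (1997), proof of Lemma 2.3.2:
`η(g) = φ(Q(g_∞ - 1)) φ(Q(g_∞⁻¹ - 1)) · 𝟙_{K_f(𝔫)}(g_f)` with `Q` the Hilbert–Schmidt form), the level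
`𝔫` and the support clause being exported here. [cite: Bump1997, proof of Lemma 2.3.2 (PDF p. 163)] -/
theorem exists_symmetric_productTestWeight {V : Set (GL (Fin n) (AdeleRing (𝓞 K) K))}
    (hV : V ∈ 𝓝 (1 : GL (Fin n) (AdeleRing (𝓞 K) K))) :
    ∃ (η : GL (Fin n) (AdeleRing (𝓞 K) K) → ℝ) (𝔫 : Ideal (𝓞 K)), IsTestFunctionGL n K η ∧ 0 ≤ η ∧
      η 1 = 1 ∧ (∀ g, η g⁻¹ = η g) ∧ 𝔫 ≠ 0 ∧
      (∀ u ∈ principalCongruenceLevel n K 𝔫, ∀ g, η (u * g) = η g) ∧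
      (∀ u ∈ principalCongruenceLevel n K 𝔫, ∀ g, η (g * u) = η g) ∧
      (∀ g, η g ≠ 0 → GLn.ofFinite n K (GLn.sndHom n K g) ∈ principalCongruenceLevel n K 𝔫) ∧
      Function.support η ⊆ V := by
  -- an open `V₁ ∋ 1` with `V₁ V₁ ⊆ V`, and a level `K(𝔫) ⊆ V₁`
  obtain ⟨V₁, hV₁o, h1V₁, hVV⟩ := exists_open_nhds_one_mul_subset hV
  obtain ⟨𝔫, h𝔫, hKV⟩ := exists_principalCongruenceLevel_subset n K (hV₁o.mem_nhds h1V₁)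
  -- the archimedean neighbourhood `W = {x | (x, 1) ∈ V₁}` as a neighbourhood of `1` in matrices
  have hVinf : (GLn.ofInfinite n K) ⁻¹' V₁ ∈ 𝓝 (1 : GL (Fin n) (mixedSpace K)) :=
    (GLn.continuous_ofInfinite n K).continuousAt.preimage_mem_nhds
      (by rw [map_one]; exact hV₁o.mem_nhds h1V₁)
  have hW : (Units.val '' ((GLn.ofInfinite n K) ⁻¹' V₁)) ∈
      𝓝 (1 : Matrix (Fin n) (Fin n) (mixedSpace K)) := by
    have h := (Units.isOpenEmbedding_val
      (R := Matrix (Fin n) (Fin n) (mixedSpace K))).image_mem_nhds.2 hVinf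
    rwa [Units.val_one] at h
  obtain ⟨ε₀, hε₀, hball⟩ := Metric.mem_nhds_iff.1 hW
  -- the radius of the bump, by coercivity of `Q`
  obtain ⟨r, hr, hrε⟩ := exists_hsQ_lt_imp_norm_lt (n := n) (K := K) (half_pos hε₀)
  let φ : ContDiffBump (0 : ℝ) := ⟨r / 2, r, half_pos hr, half_lt_self hr⟩
  have hφr : φ.rOut = r := rfl
  have hαsupp : ∀ x : GL (Fin n) (mixedSpace K), archBump φ x ≠ 0 →
      ‖(x : Matrix (Fin n) (Fin n) (mixedSpace K)) - 1‖ < ε₀ / 2 := fun x hx ↦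
    hrε _ (hφr ▸ hsQ_lt_of_archBump_ne_zero φ hx)
  have hαV : ∀ x : GL (Fin n) (mixedSpace K), archBump φ x ≠ 0 → GLn.ofInfinite n K x ∈ V₁ := by
    intro x hx
    have hxb : (x : Matrix (Fin n) (Fin n) (mixedSpace K)) ∈ Metric.ball 1 ε₀ := by
      rw [Metric.mem_ball, dist_eq_norm]
      linarith [hαsupp x hx, hε₀]
    obtain ⟨u, hu, hueq⟩ := hball hxb
    have : u = x := Units.ext hueq
    rw [← this]
    exact hu
  -- the finite part: the clopen set `{g | g_f ∈ K_f(𝔫)}`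
  set S : Set (GL (Fin n) (AdeleRing (𝓞 K) K)) := (GLn.sndHom n K) ⁻¹'
    (finitePrincipalCongruenceLevel n K 𝔫 : Set (GL (Fin n) (FiniteAdeleRing (𝓞 K) K))) with hS
  have hSclopen : IsClopen S := isClopen_preimage_sndHom_finitePrincipalCongruenceLevel n K h𝔫
  have hS_iff : ∀ g : GL (Fin n) (AdeleRing (𝓞 K) K), g ∈ S ↔
      GLn.ofFinite n K (GLn.sndHom n K g) ∈ principalCongruenceLevel n K 𝔫 := fun g ↦ Iff.rfl
  have hS_mul : ∀ (g : GL (Fin n) (AdeleRing (𝓞 K) K)) (h : GL (Fin n) (mixedSpace K)),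
      g * GLn.ofInfinite n K h ∈ S ↔ g ∈ S := by
    intro g h
    rw [hS_iff, hS_iff, map_mul, GLn.sndHom_ofInfinite, mul_one]
  have hS_inv : ∀ g : GL (Fin n) (AdeleRing (𝓞 K) K), g⁻¹ ∈ S ↔ g ∈ S := by
    intro g
    rw [hS_iff, hS_iff, map_inv, map_inv]
    exact Subgroup.inv_mem_iff _
  -- the function
  set η : GL (Fin n) (AdeleRing (𝓞 K) K) → ℝ := fun g ↦
    archBump φ (GLn.toMixed n K g) * S.indicator (fun _ ↦ (1 : ℝ)) g with hη
  have hη_apply : ∀ g, η g = archBump φ (GLn.toMixed n K g) * S.indicator (fun _ ↦ (1 : ℝ)) g :=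
    fun g ↦ rfl
  have hind0 : ∀ g, 0 ≤ S.indicator (fun _ ↦ (1 : ℝ)) g := fun g ↦
    Set.indicator_nonneg (fun _ _ ↦ zero_le_one) g
  have hη0 : ∀ g, 0 ≤ η g := fun g ↦ mul_nonneg (archBump_nonneg φ _) (hind0 g)
  -- support control: `η g ≠ 0 → (g_∞, 1) ∈ V₁ ∧ (1, g_f) ∈ K(𝔫)`
  have hsupp : ∀ g, η g ≠ 0 →
      GLn.ofInfinite n K (GLn.toMixed n K g) ∈ V₁ ∧
        GLn.ofFinite n K (GLn.sndHom n K g) ∈ principalCongruenceLevel n K 𝔫 := by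
    intro g hg
    rw [hη_apply] at hg
    have hSg : g ∈ S := by
      by_contra hgS
      rw [Set.indicator_of_notMem hgS, mul_zero] at hg
      exact hg rfl
    exact ⟨hαV _ (left_ne_zero_of_mul hg), (hS_iff g).1 hSg⟩
  have hcont : Continuous η :=
    ((continuous_archBump φ).comp (GLn.continuous_toMixed n K)).mul
      (hSclopen.continuous_indicator continuous_const)
  -- compact support: `supp η ⊆ (C, 1) · K(𝔫)`, `C = {x | ‖x - 1‖ ≤ ε₀/2}` compact in `GL_n(K_∞)`
  have hcs : HasCompactSupport η := by
    haveI : ProperSpace (Matrix (Fin n) (Fin n) (mixedSpace K)) := FiniteDimensional.proper ℝ _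
    set C : Set (GL (Fin n) (mixedSpace K)) :=
      Units.val ⁻¹' Metric.closedBall (1 : Matrix (Fin n) (Fin n) (mixedSpace K)) (ε₀ / 2) with hC
    have hCsub : Metric.closedBall (1 : Matrix (Fin n) (Fin n) (mixedSpace K)) (ε₀ / 2) ⊆
        Set.range (Units.val :
          GL (Fin n) (mixedSpace K) → Matrix (Fin n) (Fin n) (mixedSpace K)) := by
      intro y hy
      have hyb : y ∈ Metric.ball (1 : Matrix (Fin n) (Fin n) (mixedSpace K)) ε₀ :=
        Metric.closedBall_subset_ball (half_lt_self hε₀) hy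
      obtain ⟨u, -, rfl⟩ := hball hyb
      exact ⟨u, rfl⟩
    have hCc : IsCompact C :=
      (Units.isOpenEmbedding_val
        (R := Matrix (Fin n) (Fin n) (mixedSpace K))).isInducing.isCompact_preimage'
        (isCompact_closedBall _ _) hCsub
    refine HasCompactSupport.of_support_subset_isCompact
      ((hCc.image (GLn.continuous_ofInfinite n K)).mul (isCompact_principalCongruenceLevel n K h𝔫))
      fun g hg ↦ ?_
    obtain ⟨-, h2⟩ := hsupp g hg
    have hαg : archBump φ (GLn.toMixed n K g) ≠ 0 := by
      rw [Function.mem_support, hη_apply] at hg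
      exact left_ne_zero_of_mul hg
    have h1 : GLn.toMixed n K g ∈ C := by
      rw [hC, Set.mem_preimage, Metric.mem_closedBall, dist_eq_norm]
      exact (hαsupp _ hαg).le
    rw [← GLn.ofInfinite_toMixed_mul_ofFinite_sndHom g]
    exact Set.mul_mem_mul (Set.mem_image_of_mem _ h1) h2
  -- right invariance under `K(𝔫)`
  have hright : ∀ u ∈ principalCongruenceLevel n K 𝔫, ∀ g, η (g * u) = η g := by
    intro u hu g
    have hu' : GLn.ofFinite n K (GLn.sndHom n K u) = u :=
      GLn.ofFinite_sndHom_of_mem (principalCongruenceLevel_le n K 𝔫 hu)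
    have htm : GLn.toMixed n K u = 1 := by rw [← hu', GLn.toMixed_ofFinite]
    have hSu : g * u ∈ S ↔ g ∈ S := by
      rw [hS_iff, hS_iff, map_mul, map_mul, hu']
      exact Subgroup.mul_mem_cancel_right _ hu
    rw [hη_apply, hη_apply, map_mul, htm, mul_one]
    congr 1
    rw [Set.indicator_apply, Set.indicator_apply]
    simp only [hSu]
  -- left invariance under `K(𝔫)`
  have hleft : ∀ u ∈ principalCongruenceLevel n K 𝔫, ∀ g, η (u * g) = η g := by
    intro u hu g
    have hu' : GLn.ofFinite n K (GLn.sndHom n K u) = u :=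
      GLn.ofFinite_sndHom_of_mem (principalCongruenceLevel_le n K 𝔫 hu)
    have htm : GLn.toMixed n K u = 1 := by rw [← hu', GLn.toMixed_ofFinite]
    have hSu : u * g ∈ S ↔ g ∈ S := by
      rw [hS_iff, hS_iff, map_mul, map_mul, hu']
      exact Subgroup.mul_mem_cancel_left _ hu
    rw [hη_apply, hη_apply, map_mul, htm, one_mul]
    congr 1
    rw [Set.indicator_apply, Set.indicator_apply]
    simp only [hSu]
  have h1S : (1 : GL (Fin n) (AdeleRing (𝓞 K) K)) ∈ S := by
    rw [hS_iff, map_one, map_one]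
    exact one_mem _
  have hη1 : η 1 = 1 := by
    rw [hη_apply, map_one, archBump_one, Set.indicator_of_mem h1S, mul_one]
  refine ⟨η, 𝔫, ⟨hcont, hcs, ?_, ?_⟩, hη0, hη1, ?_, h𝔫, hleft, hright, fun g hg => (hsupp g hg).2, ?_⟩
  · -- archimedean smoothness
    intro (g : GL (Fin n) (AdeleRing (𝓞 K) K))
    show ContDiff ℝ ∞ fun X : (archGroupGL n K).lie.toSubmodule ↦
      ((η (g * GLn.ofInfinite n K (expGL (X : Matrix (Fin n) (Fin n) (mixedSpace K)))) : ℝ) : ℂ)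
    have hconst : (fun X : (archGroupGL n K).lie.toSubmodule ↦
        ((η (g * GLn.ofInfinite n K (expGL (X : Matrix (Fin n) (Fin n) (mixedSpace K)))) : ℝ) :
          ℂ)) =
        fun X : (archGroupGL n K).lie.toSubmodule ↦
          ((archBump φ (GLn.toMixed n K g * expGL (X : Matrix (Fin n) (Fin n) (mixedSpace K))) *
            S.indicator (fun _ ↦ (1 : ℝ)) g : ℝ) : ℂ) := by
      funext X
      rw [hη_apply, map_mul, GLn.toMixed_ofInfinite]
      congr 2
      rw [Set.indicator_apply, Set.indicator_apply]
      simp only [hS_mul]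
    rw [hconst]
    have hval : ContDiff ℝ ∞ fun X : (archGroupGL n K).lie.toSubmodule ↦
        (X : Matrix (Fin n) (Fin n) (mixedSpace K)) :=
      (archGroupGL n K).lie.toSubmodule.subtypeL.contDiff
    exact Complex.ofRealCLM.contDiff.comp
      (((contDiff_archBump_mul_expGL φ (GLn.toMixed n K g)).comp hval).mul contDiff_const)
  · -- the level
    exact ⟨principalCongruenceLevel n K 𝔫, principalCongruenceLevel_mem_finiteLevelsGL_holds n K h𝔫,
      fun u hu g ↦ hright u hu g⟩
  · -- symmetry under `g ↦ g⁻¹`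
    intro g
    rw [hη_apply, hη_apply, map_inv, archBump_inv]
    congr 1
    rw [Set.indicator_apply, Set.indicator_apply]
    simp only [hS_inv]
  · -- support
    intro g hg
    obtain ⟨h1, h2⟩ := hsupp g hg
    rw [← GLn.ofInfinite_toMixed_mul_ofFinite_sndHom g]
    exact hVV (Set.mul_mem_mul h1 (hKV h2))

end Product

/-! ### 2. The local level `U_v = K(𝔫)_v` and the product structure at `v` -/

section LevelAtDef

/-- **The local level `U_v = K(𝔫)_v ≤ GL_n(K_v)`** of the principal congruence subgroup `K(𝔫)`: the
valued congruence subgroup of radius `|𝔫|_v` (`v`-integral `x` with `x⁻¹` integral and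
`|x - 1|_v ≤ |𝔫|_v`). An abbreviation for `valuedCongruenceSubgroup (Fin n) (idealRadius K v 𝔫)`
(`GLnAdelicStructure`), introduced only to fix the implicit field. [folklore] -/
abbrev levelAt (n : ℕ) (K : Type) [Field K] [NumberField K] (v : HeightOneSpectrum (𝓞 K))
    (𝔫 : Ideal (𝓞 K)) : Subgroup (GL (Fin n) (v.adicCompletion K)) :=
  valuedCongruenceSubgroup (Fin n) (idealRadius K v 𝔫)

end LevelAtDef

section LevelAt

variable {n : ℕ} {K : Type} [Field K] [NumberField K] (v : HeightOneSpectrum (𝓞 K)) {𝔫 : Ideal (𝓞 K)}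

/-- `|𝔫|_v = exp(-m)` for the natural number `m = v(𝔫)` (`FractionalIdeal.count_coe`), `𝔫 ≠ 0`.
[folklore] -/
theorem idealRadius_eq_exp_neg_natCast (h𝔫 : 𝔫 ≠ 0) :
    idealRadius K v 𝔫 =
      WithZero.exp (-((Associates.mk v.asIdeal).count (Associates.mk 𝔫).factors : ℤ)) := by
  rw [idealRadius, FractionalIdeal.count_coe K v h𝔫]

/-- **The local level `U_v = K(𝔫)_v` is a local principal congruence subgroup**
(`localCongruenceSubgroup n K v m`, `m = v(𝔫)`), in particular compact and open. [folklore] -/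
theorem levelAt_eq_localCongruenceSubgroup (h𝔫 : 𝔫 ≠ 0) :
    levelAt n K v 𝔫 =
      localCongruenceSubgroup n K v ((Associates.mk v.asIdeal).count (Associates.mk 𝔫).factors) := by
  rw [levelAt, localCongruenceSubgroup, idealRadius_eq_exp_neg_natCast v h𝔫]

/-- `U_v` is compact and open. [folklore] -/
theorem isCompact_isOpen_levelAt (h𝔫 : 𝔫 ≠ 0) :
    IsCompact ((levelAt n K v 𝔫 : Subgroup (GL (Fin n) (v.adicCompletion K))) : Set (GL (Fin n) (v.adicCompletion K))) ∧
      IsOpen ((levelAt n K v 𝔫 : Subgroup (GL (Fin n) (v.adicCompletion K))) : Set (GL (Fin n) (v.adicCompletion K))) := by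
  rw [levelAt_eq_localCongruenceSubgroup v h𝔫]
  exact ⟨isCompact_localCongruenceSubgroup n K v _, isOpen_localCongruenceSubgroup n K v _⟩

/-- An element of `U_v` is `v`-integral (the radius `|𝔫|_v` is `≤ 1`). [folklore] -/
theorem mem_valuedCongruenceSubgroup_one_of_mem_levelAt (h𝔫 : 𝔫 ≠ 0) {x : GL (Fin n) (v.adicCompletion K)}
    (hx : x ∈ levelAt n K v 𝔫) :
    x ∈ valuedCongruenceSubgroup (Fin n) (1 : WithZero (Multiplicative ℤ)) := by
  have hx' : x ∈ valuedCongruenceSubgroup (Fin n) (idealRadius K v 𝔫) := hx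
  obtain ⟨h1, h2, h3⟩ := hx'
  refine ⟨h1, h2, fun i j => (h3 i j).trans ?_⟩
  rw [idealRadius_eq_exp_neg_natCast v h𝔫, ← WithZero.exp_zero, WithZero.exp_le_exp]
  omega

/-- **`ι_v(U_v) ⊆ K(𝔫)`.** [folklore] -/
theorem ofLocal_mem_principalCongruenceLevel_of_mem_levelAt (h𝔫 : 𝔫 ≠ 0)
    {x : GL (Fin n) (v.adicCompletion K)} (hx : x ∈ levelAt n K v 𝔫) :
    GLn.ofLocal n K v x ∈ principalCongruenceLevel n K 𝔫 := by
  rw [mem_principalCongruenceLevel_iff]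
  refine ⟨isMaximalAt_glIntegralLevel n K v ⟨x, mem_valuedCongruenceSubgroup_one_of_mem_levelAt v h𝔫 hx, rfl⟩,
    fun w => ?_⟩
  by_cases hw : w = v
  · subst hw
    rw [GLn.toLocal_ofLocal]
    exact hx
  · rw [GLn.toLocal_ofLocal_of_ne hw]
    exact one_mem _

/-- The `v`-component of `g` is that of its finite part `g_f`. [folklore] -/
theorem toLocalAt_ofFinite_sndHom (g : GL (Fin n) (AdeleRing (𝓞 K) K)) :
    GLn.toLocalAt n K v (GLn.ofFinite n K (GLn.sndHom n K g)) = GLn.toLocalAt n K v g := by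
  have h : GLn.toLocalAt n K v g =
      GLn.toLocalAt n K v (GLn.ofInfinite n K (GLn.toMixed n K g) * GLn.ofFinite n K (GLn.sndHom n K g)) := by
    rw [GLn.ofInfinite_toMixed_mul_ofFinite_sndHom g]
  rw [h, GLn.toLocalAt_mul', GLn.toLocalAt_ofInfinite, one_mul]

/-- **Support in `{g_f ∈ K_f(𝔫)}` forces `g_v ∈ U_v`.** [folklore] -/
theorem toLocalAt_mem_levelAt_of_apply_ne_zero {η : GL (Fin n) (AdeleRing (𝓞 K) K) → ℝ}
    (hsupp : ∀ g, η g ≠ 0 → GLn.ofFinite n K (GLn.sndHom n K g) ∈ principalCongruenceLevel n K 𝔫)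
    {g : GL (Fin n) (AdeleRing (𝓞 K) K)} (hg : η g ≠ 0) :
    GLn.toLocalAt n K v g ∈ levelAt n K v 𝔫 := by
  have h := (mem_principalCongruenceLevel_iff.1 (hsupp g hg)).2 v
  rw [← toLocalAt_ofFinite_sndHom v g]
  exact h

/-- **`ξ_{U_v} = η`: a right `K(𝔫)`-invariant weight supported in `{g_f ∈ K_f(𝔫)}` is its own local
test weight at every finite place `v`** (`localTestWeight v η U_v g = η(s_v g) 𝟙_{U_v}(g_v)` with
`s_v(g) = g ι_v(g_v)⁻¹`; if `g_v ∈ U_v` then `η(s_v g) = η(s_v(g) ι_v(g_v)) = η(g)` by the invariance,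
and otherwise both sides vanish). [folklore] -/
theorem localTestWeight_levelAt_apply_eq_self (h𝔫 : 𝔫 ≠ 0) {η : GL (Fin n) (AdeleRing (𝓞 K) K) → ℝ}
    (hright : ∀ u ∈ principalCongruenceLevel n K 𝔫, ∀ g, η (g * u) = η g)
    (hsupp : ∀ g, η g ≠ 0 → GLn.ofFinite n K (GLn.sndHom n K g) ∈ principalCongruenceLevel n K 𝔫)
    (g : GL (Fin n) (AdeleRing (𝓞 K) K)) :
    localTestWeight v (show (AdelicGroupData.gl n K).Adelic → ℝ from η)
        ((levelAt n K v 𝔫 : Subgroup (GL (Fin n) (v.adicCompletion K))) : Set (GL (Fin n) (v.adicCompletion K))) g =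
      η g := by
  by_cases hg : GLn.toLocalAt n K v g ∈
      ((levelAt n K v 𝔫 : Subgroup (GL (Fin n) (v.adicCompletion K))) : Set (GL (Fin n) (v.adicCompletion K)))
  · rw [localTestWeight_of_mem _ hg]
    -- `η(s_v g) = η(g ι_v(g_v)⁻¹) = η(g)` by the right invariance under `ι_v(g_v) ∈ K(𝔫)`
    set u : GL (Fin n) (AdeleRing (𝓞 K) K) := GLn.ofLocal n K v (GLn.toLocalAt n K v g) with hu
    have huK : u ∈ principalCongruenceLevel n K 𝔫 := ofLocal_mem_principalCongruenceLevel_of_mem_levelAt v h𝔫 hg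
    have h1 := hright u huK (g * u⁻¹)
    rw [inv_mul_cancel_right] at h1
    -- `s_v g = g ι_v(g_v)⁻¹` (the definition of `GLn.awayFrom`, read in `GL_n(𝔸_K)`)
    exact h1.symm
  · rw [localTestWeight_of_notMem _ hg]
    by_contra hne
    exact hg (toLocalAt_mem_levelAt_of_apply_ne_zero v hsupp (Ne.symm hne))

/-- **`ξ_{U_v} = η`** as functions on `GL_n(𝔸_K)` (`localTestWeight_levelAt_apply_eq_self`). [folklore] -/
theorem localTestWeight_levelAt_eq_self (h𝔫 : 𝔫 ≠ 0) {η : GL (Fin n) (AdeleRing (𝓞 K) K) → ℝ}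
    (hright : ∀ u ∈ principalCongruenceLevel n K 𝔫, ∀ g, η (g * u) = η g)
    (hsupp : ∀ g, η g ≠ 0 → GLn.ofFinite n K (GLn.sndHom n K g) ∈ principalCongruenceLevel n K 𝔫) :
    localTestWeight v (show (AdelicGroupData.gl n K).Adelic → ℝ from η)
        ((levelAt n K v 𝔫 : Subgroup (GL (Fin n) (v.adicCompletion K))) : Set (GL (Fin n) (v.adicCompletion K))) =
      (show (AdelicGroupData.gl n K).Adelic → ℝ from η) :=
  funext fun g => localTestWeight_levelAt_apply_eq_self v h𝔫 hright hsupp g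

end LevelAt

/-! ### 3. An eigenvector of `R(η)` in `Π` for a symmetric product weight `η` -/

section Eigen

variable {n : ℕ} {K : Type} [Field K] [NumberField K]
  {μ : Measure (AdelicGroupData.gl n K).automorphicQuotient}
  [(AdelicGroupData.gl n K).IsAutomorphicMeasure μ]

/-- **An eigenvector of a product smoothing operator in every cuspidal `Π`** (Bump (1997), proofs of
Thm. 3.2.2–3.2.3: `ρ(φ)` is compact, self-adjoint for `φ(g⁻¹) = φ(g)`, and non-zero on a given
`f₀ ≠ 0` for `φ ≥ 0` supported where `Re ⟪f₀, R(g) f₀⟫ > ‖f₀‖²/2`; Gelfand–Graev–Piatetski-Shapiro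
(1969), Ch. 3). For a cuspidal automorphic representation `Π` of `GL_n(𝔸_K)` there are `0 ≠ f ∈ Π`,
a symmetric non-negative product test function `η` with `η(1) = 1` and its level `𝔫 ≠ 0`
(`exists_symmetric_productTestWeight`), and a real `c ≠ 0` with `R(η) f = c f`.
[cite: Bump1997, proof of Thm. 3.2.3 (PDF p. 281)] -/
theorem CuspidalAutomorphicRepGL.exists_eigen_productTestVector (P : CuspidalAutomorphicRepGL n K μ) :
    ∃ (f : P.1.toSubmodule) (η : GL (Fin n) (AdeleRing (𝓞 K) K) → ℝ) (𝔫 : Ideal (𝓞 K)) (c : ℝ),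
      f ≠ 0 ∧ c ≠ 0 ∧ IsTestFunctionGL n K η ∧ 0 ≤ η ∧ η 1 = 1 ∧ (∀ g, η g⁻¹ = η g) ∧ 𝔫 ≠ 0 ∧
      (∀ u ∈ principalCongruenceLevel n K 𝔫, ∀ g, η (u * g) = η g) ∧
      (∀ u ∈ principalCongruenceLevel n K 𝔫, ∀ g, η (g * u) = η g) ∧
      (∀ g, η g ≠ 0 → GLn.ofFinite n K (GLn.sndHom n K g) ∈ principalCongruenceLevel n K 𝔫) ∧
      smoothedVector P.1 η f = (c : ℂ) • f := by
  haveI : (adelicHaar n K).IsInvInvariant := adelicHaar_isInvInvariant n K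
  set W := P.1 with hW
  -- a non-zero vector of `Π`
  haveI : Nontrivial W.toSubmodule :=
    ((ContRepresentation.isTopIrreducible_iff _).1 P.isTopIrreducible).1
  obtain ⟨f₀, hf0⟩ := exists_ne (0 : W.toSubmodule)
  set F := ((f₀ : W.toSubmodule) : (AdelicGroupData.gl n K).L2 μ) with hF
  -- the open neighbourhood of `1` where `Re ⟪F, R(g) F⟫ > ‖F‖²/2`
  set V : Set (AdelicGroupData.gl n K).Adelic :=
    {g | ‖F‖ ^ 2 / 2 < RCLike.re (inner ℂ F ((AdelicGroupData.gl n K).rightRegular μ g F))} with hV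
  have hcontV : Continuous fun g =>
      RCLike.re (inner ℂ F ((AdelicGroupData.gl n K).rightRegular μ g F)) :=
    RCLike.continuous_re.comp (continuous_const.inner
      ((AdelicGroupData.isStronglyContinuous_rightRegular_holds (AdelicGroupData.gl n K) μ) F))
  have hVo : IsOpen V := isOpen_lt continuous_const hcontV
  have hF0 : F ≠ 0 := fun h => hf0 (Subtype.ext h)
  have h1V : (1 : (AdelicGroupData.gl n K).Adelic) ∈ V := by
    change ‖F‖ ^ 2 / 2 < RCLike.re (inner ℂ F ((AdelicGroupData.gl n K).rightRegular μ 1 F))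
    rw [map_one]
    change ‖F‖ ^ 2 / 2 < RCLike.re (inner ℂ F F)
    rw [inner_self_eq_norm_sq_to_K]
    norm_cast
    have : 0 < ‖F‖ ^ 2 := by positivity
    linarith
  -- the product weight supported in `V`
  obtain ⟨η, 𝔫, hη, hη0, hη1, hηsymm, h𝔫, hleft, hright, hsupp𝔫, hsuppV⟩ :=
    exists_symmetric_productTestWeight (n := n) (K := K) (hVo.mem_nhds h1V)
  have hηc : Continuous η := hη.continuous
  have hηs : HasCompactSupport η := hη.hasCompactSupport
  have hηc' : @Continuous (AdelicGroupData.gl n K).Adelic ℝ _ _ η := hηc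
  have hηs' : @HasCompactSupport (AdelicGroupData.gl n K).Adelic ℝ _ _ η := hηs
  have hmass : 0 < ∫ g, η g ∂(adelicHaar n K) :=
    hηc'.integral_pos_of_hasCompactSupport_nonneg_nonzero hηs' hη0 (by rw [hη1]; exact one_ne_zero)
  -- the operator `T = R(η)`: non-zero, compact, self-adjoint
  set T : W.toSubmodule →L[ℂ] W.toSubmodule := smoothedVectorL W hηc' hηs' with hT
  have hTf : T f₀ ≠ 0 := by
    rw [hT, smoothedVectorL_apply]
    exact smoothedVector_ne_zero_of_support_subset W hηc' hηs' hη0 hmass hf0 hsuppV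
  have hT0 : T ≠ 0 := fun h => hTf (by rw [h]; rfl)
  have hTc : IsCompactOperator T :=
    isCompactOperator_smoothedVector_of_le_cuspidalSubspace P.le_cuspidalSubspace hηc' hηs'
  have hTsa : IsSelfAdjoint T := isSelfAdjoint_smoothedVectorL W hηc' hηs' hηsymm
  have hTsym : (T : W.toSubmodule →ₗ[ℂ] W.toSubmodule).IsSymmetric :=
    (ContinuousLinearMap.isSelfAdjoint_iff_isSymmetric).1 hTsa
  -- a non-zero (real) eigenvalue with an eigenvector
  obtain ⟨lam, hlam, hlam0⟩ :
      ∃ lam : ℂ, Module.End.HasEigenvalue (T : Module.End ℂ W.toSubmodule) lam ∧ lam ≠ 0 := by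
    by_contra h
    push Not at h
    exact hT0 ((ContinuousLinearMap.eq_zero_of_forall_hasEigenvalue_eq_zero hTc hTsym).1 h)
  obtain ⟨e, he⟩ := hlam.exists_hasEigenvector
  have hemem : T e = lam • e := Module.End.mem_eigenspace_iff.1 he.1
  have he0 : e ≠ 0 := he.2
  have hreal : ((lam.re : ℝ) : ℂ) = lam :=
    Complex.conj_eq_iff_re.1 (hTsym.conj_eigenvalue_eq_self hlam)
  have hre0 : lam.re ≠ 0 := fun h => hlam0 (by rw [← hreal, h, Complex.ofReal_zero])
  refine ⟨e, η, 𝔫, lam.re, he0, hre0, hη, hη0, hη1, hηsymm, h𝔫, hleft, hright, hsupp𝔫, ?_⟩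
  rw [← smoothedVectorL_apply W hηc' hηs', ← hT, hemem, hreal]

/-- **The eigenvector is locally an eigenvector of the local smoothings, at every finite place.** For
the datum `(f, η, 𝔫, c)` of `exists_eigen_productTestVector` and a finite place `v` with local level
`U_v = K(𝔫)_v`: `f` is `ι_v(U_v)`-fixed, `R_{U_v} f = c f` (`ξ_{U_v} = η`,
`localTestWeight_levelAt_eq_self`), hence `f ∈ E_{c / mass(U_v)}`, the `GL_n(K_v)`-stable space of
joint eigenvectors of `GLnCuspidalSpectrumProofs` (`mem_localEigenspace_of_level`).
[cite: Bump1997, proof of Thm. 3.3.3 (PDF p. 296)] -/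
theorem CuspidalAutomorphicRepGL.mem_localEigenspace_of_eigen_productTestVector (P : CuspidalAutomorphicRepGL n K μ)
    {f : P.1.toSubmodule} {η : GL (Fin n) (AdeleRing (𝓞 K) K) → ℝ} {𝔫 : Ideal (𝓞 K)} {c : ℝ}
    (hc : c ≠ 0) (hη : IsTestFunctionGL n K η) (hη0 : 0 ≤ η) (hη1 : η 1 = 1) (h𝔫 : 𝔫 ≠ 0)
    (hleft : ∀ u ∈ principalCongruenceLevel n K 𝔫, ∀ g, η (u * g) = η g)
    (hright : ∀ u ∈ principalCongruenceLevel n K 𝔫, ∀ g, η (g * u) = η g)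
    (hsupp : ∀ g, η g ≠ 0 → GLn.ofFinite n K (GLn.sndHom n K g) ∈ principalCongruenceLevel n K 𝔫)
    (heig : smoothedVector P.1 η f = (c : ℂ) • f) (v : HeightOneSpectrum (𝓞 K)) :
    f ∈ P.1.fixedVectors ((levelAt n K v 𝔫).map (GLn.toAdelic n K v)) ∧
      localSmoothing v P.1 η (levelAt n K v 𝔫) f = (c : ℂ) • f ∧
      f ∈ localEigenspace v P.1 hη.continuous hη.hasCompactSupport
        (c / localMass v η (levelAt n K v 𝔫)) := by
  have hηc : Continuous η := hη.continuous
  have hηs : HasCompactSupport η := hη.hasCompactSupport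
  have hU := isCompact_isOpen_levelAt (n := n) v h𝔫
  -- `f = c⁻¹ R(η) f` is fixed by `K(𝔫) ⊇ ι_v(U_v)`
  have hfix : f ∈ P.1.fixedVectors ((levelAt n K v 𝔫).map (GLn.toAdelic n K v)) := by
    have hle : (levelAt n K v 𝔫).map (GLn.toAdelic n K v) ≤
        principalCongruenceLevel n K 𝔫 := by
      rintro _ ⟨x, hx, rfl⟩
      exact ofLocal_mem_principalCongruenceLevel_of_mem_levelAt v h𝔫 hx
    have hmem : smoothedVector P.1 η f ∈ P.1.fixedVectors (principalCongruenceLevel n K 𝔫) :=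
      smoothedVector_mem_fixedVectors P.1 hηc hηs (fun k hk g => hleft k hk g) f
    have hf : f = (c : ℂ)⁻¹ • smoothedVector P.1 η f := by
      rw [heig, smul_smul, inv_mul_cancel₀ (Complex.ofReal_ne_zero.2 hc), one_smul]
    rw [hf]
    exact P.1.fixedVectors_antitone hle (Submodule.smul_mem _ _ hmem)
  -- `R_{U_v} f = R(η) f = c f`
  have hloc : localSmoothing v P.1 η (levelAt n K v 𝔫) f = (c : ℂ) • f := by
    rw [localSmoothing, localTestWeight_levelAt_eq_self v h𝔫 hright hsupp, heig]
  refine ⟨hfix, hloc, mem_localEigenspace_of_level hU hfix ?_⟩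
  have hm : 0 < localMass v η (levelAt n K v 𝔫) :=
    localMass_pos hηc hηs hη0 (lt_of_lt_of_eq one_pos hη1.symm) hU
  rw [hloc, div_mul_cancel₀ _ hm.ne']

/-- **A test vector of a cuspidal `Π` generating an admissible `GL_n(K_v)`-module at every finite
place.** For every cuspidal automorphic representation `Π` of `GL_n(𝔸_K)` there are `0 ≠ f ∈ Π`, a
test function `η ≥ 0` with `η(g⁻¹) = η(g)`, `η(1) = 1`, and a real `c ≠ 0` with `R(η) f = c f` — so the
smoothed form `S_η f` represents `c f ≠ 0` — such that for every finite place `v` the vector `f` lies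
in a `GL_n(K_v)`-stable subspace `E ≤ Π` all of whose spaces of `ι_v(U)`-fixed vectors, `U ≤ GL_n(K_v)`
compact open, are finite-dimensional (Bump (1997), Thm. 3.3.3 and its proof: admissibility through
the finite-dimensionality of `K`-fixed eigenspaces of compact operators; here with no appeal to the
admissibility of `Π`). [cite: Bump1997, Thm. 3.3.3 and proof (PDF p. 296)] -/
theorem CuspidalAutomorphicRepGL.exists_eigen_productTestVector_locallyAdmissible
    (P : CuspidalAutomorphicRepGL n K μ) :
    ∃ (f : P.1.toSubmodule) (η : GL (Fin n) (AdeleRing (𝓞 K) K) → ℝ) (c : ℝ),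
      f ≠ 0 ∧ c ≠ 0 ∧ IsTestFunctionGL n K η ∧ 0 ≤ η ∧ η 1 = 1 ∧ (∀ g, η g⁻¹ = η g) ∧
      smoothedVector P.1 η f = (c : ℂ) • f ∧
      ∀ v : HeightOneSpectrum (𝓞 K), ∃ E : Submodule ℂ P.1.toSubmodule, f ∈ E ∧
        (∀ (l : GL (Fin n) (v.adicCompletion K)) (x : P.1.toSubmodule), x ∈ E →
          P.1.toContRep (GLn.toAdelic n K v l) x ∈ E) ∧
        ∀ U : Subgroup (GL (Fin n) (v.adicCompletion K)),
          IsCompact (U : Set (GL (Fin n) (v.adicCompletion K))) ∧ IsOpen (U : Set (GL (Fin n) (v.adicCompletion K))) →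
          FiniteDimensional ℂ ↥(E ⊓ P.1.fixedVectors (U.map (GLn.toAdelic n K v))) := by
  obtain ⟨f, η, 𝔫, c, hf0, hc, hη, hη0, hη1, hηsymm, h𝔫, hleft, hright, hsupp, heig⟩ :=
    P.exists_eigen_productTestVector
  refine ⟨f, η, c, hf0, hc, hη, hη0, hη1, hηsymm, heig, fun v => ?_⟩
  obtain ⟨-, -, hmem⟩ := P.mem_localEigenspace_of_eigen_productTestVector hc hη hη0 hη1 h𝔫 hleft hright
    hsupp heig v
  refine ⟨localEigenspace v P.1 hη.continuous hη.hasCompactSupport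
      (c / localMass v η (levelAt n K v 𝔫)), hmem,
    fun l x hx => toContRep_toAdelic_mem_localEigenspace hx l, fun U hU => ?_⟩
  have hm : 0 < localMass v η (levelAt n K v 𝔫) :=
    localMass_pos hη.continuous hη.hasCompactSupport hη0 (lt_of_lt_of_eq one_pos hη1.symm)
      (isCompact_isOpen_levelAt (n := n) v h𝔫)
  exact finiteDimensional_localEigenspace_inf_fixedVectors P.le_cuspidalSubspace hη0
    (lt_of_lt_of_eq one_pos hη1.symm) (div_ne_zero hc hm.ne') hU

end Eigen

end Literature.NumberTheory.Automorphic
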